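import Mathlib
import HarnessLib
import Literature.Probability.MarkovChains.TotalVariation

/-!
# Birth-and-death chains are reversible: `w_k = Π_{i=1}^k p_{i−1}/q_i` (Levin–Peres–Wilmer §2.5, Proposition 2.8)

HONEST FRAMING: exact (Metropolis-corrected) sampling algorithms for lattice gauge theory; figures
of merit are autocorrelation/cost numbers at stated couplings and volumes; no continuum-physics claim.

Conventions of `TotalVariation.lean` (`IsRowStochastic`) and `MetropolisHastings.lean`
(`DetailedBalance π P`, `IsStationary π P`, Prop. 1.20 = `DetailedBalance.isStationary`).  Source:
D. A. Levin, Y. Peres (with E. L. Wilmer), *Markov Chains and Mixing Times*, 2nd ed., AMS 2017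
[LevinPeres2017], §2.5 "Birth-and-death chains", p. 26, Proposition 2.8.  Everything is PROVED
(finite sums; 0 named facts).

The state space is `{0, 1, …, n}` = `Fin (n+1)`; the parameters are sequences `p q : ℕ → ℝ` (only the
values at `0, …, n` matter), `r_k = 1 − p_k − q_k`.

* `bdKernel n p q` — the birth-and-death chain: `P(k,k+1) = p_k`, `P(k,k−1) = q_k`, `P(k,k) = r_k =
  1 − p_k − q_k`, all other entries `0` [cite: LevinPeres2017, §2.5 (definition, the bullets for
  `p_k, q_k, r_k`)]; `bdKernel_isRowStochastic` — a transition matrix when `p, q ≥ 0`, `p_k + q_k ≤ 1`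
  and `q_0 = p_n = 0`;
* `bdWeight p q k` — **`w_k = Π_{i=1}^k p_{i−1}/q_i`** (`w_0 = 1`) and the recursion
  `p_{k−1} w_{k−1} = q_k w_k` (`bdWeight_balance`) [cite: LevinPeres2017, §2.5, proof of Prop. 2.8];
* **PROPOSITION 2.8** `LevinPeres2017_prop_2_8` — **every birth-and-death chain is reversible**: `w`
  satisfies the detailed balance equations (1.29) (for `q_k ≠ 0`, `1 ≤ k ≤ n`, as the printed
  solution requires), and `bdLaw` — `π_k = w_k / Σ_j w_j` — is a reversible stationary distribution
  (`LevinPeres2017_prop_2_8_law`, `bdLaw_isStationary`, "by Proposition 1.20")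
  [cite: LevinPeres2017, §2.5 Prop. 2.8].

NOT here: the hitting-time formula (2.13) and its consequences (2.14)–(2.16), which need the
trajectory space.

Context (cell pub-lqcd, venture LatticeQCDFlow): one-dimensional order-parameter chains (the
magnetisation or topological-charge ladder moved by ±1 per accepted update) are birth-and-death
chains; Prop. 2.8 gives their exact stationary law from the up/down rates.
-/

namespace Literature.Probability.MarkovChains

open Finset Matrix

/-- The **birth-and-death chain** on `{0, …, n}` with birth probabilities `p_k` (move `k → k+1`),
death probabilities `q_k` (move `k → k−1`) and holding probabilities `r_k = 1 − p_k − q_k`.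
[cite: LevinPeres2017, §2.5 (definition of a birth-and-death chain by `{(p_k, r_k, q_k)}`)] -/
noncomputable def bdKernel (n : ℕ) (p q : ℕ → ℝ) : Matrix (Fin (n + 1)) (Fin (n + 1)) ℝ :=
  Matrix.of fun i j =>
    if j.val = i.val + 1 then p i.val
    else if i.val = j.val + 1 then q i.val
    else if i = j then 1 - p i.val - q i.val
    else 0

/-- **`w_k = Π_{i=1}^k p_{i−1}/q_i`** (`w_0 = 1`), the unnormalised reversible measure.
[cite: LevinPeres2017, §2.5, proof of Prop. 2.8 ("a solution is given by `w_0 = 1` and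
`w_k = Π_{i=1}^k p_{i−1}/q_i`")] -/
noncomputable def bdWeight (p q : ℕ → ℝ) (k : ℕ) : ℝ := ∏ i ∈ range k, p i / q (i + 1)

/-- **`π_k = w_k / Σ_{j=0}^n w_j`**. [cite: LevinPeres2017, §2.5, proof of Prop. 2.8 ("Normalizing so
that the sum is unity yields `π_k = w_k/Σ_j w_j`")] -/
noncomputable def bdLaw (n : ℕ) (p q : ℕ → ℝ) : Fin (n + 1) → ℝ :=
  fun k => bdWeight p q k.val / ∑ j : Fin (n + 1), bdWeight p q j.val

variable {n : ℕ} {p q : ℕ → ℝ}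

/-! ## Entries of the kernel -/

/-- `P(k, k+1) = p_k`. [cite: LevinPeres2017, §2.5 (`p_k` is the probability of moving from `k` to
`k+1`)] -/
theorem bdKernel_apply_succ {i j : Fin (n + 1)} (h : j.val = i.val + 1) :
    bdKernel n p q i j = p i.val := by
  show (if j.val = i.val + 1 then p i.val else if i.val = j.val + 1 then q i.val
    else if i = j then 1 - p i.val - q i.val else 0) = p i.val
  rw [if_pos h]

/-- `P(k, k−1) = q_k`. [cite: LevinPeres2017, §2.5 (`q_k` is the probability of moving from `k` to
`k−1`)] -/
theorem bdKernel_apply_pred {i j : Fin (n + 1)} (h : i.val = j.val + 1) :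
    bdKernel n p q i j = q i.val := by
  have h' : ¬ j.val = i.val + 1 := by omega
  show (if j.val = i.val + 1 then p i.val else if i.val = j.val + 1 then q i.val
    else if i = j then 1 - p i.val - q i.val else 0) = q i.val
  rw [if_neg h', if_pos h]

/-- `P(k, k) = r_k = 1 − p_k − q_k`. [cite: LevinPeres2017, §2.5 (`r_k` is the probability of
remaining at `k`; `p_k + r_k + q_k = 1`)] -/
theorem bdKernel_apply_self (i : Fin (n + 1)) : bdKernel n p q i i = 1 - p i.val - q i.val := by
  have h' : ¬ i.val = i.val + 1 := by omega
  show (if i.val = i.val + 1 then p i.val else if i.val = i.val + 1 then q i.val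
    else if i = i then 1 - p i.val - q i.val else 0) = 1 - p i.val - q i.val
  rw [if_neg h', if_neg h', if_pos rfl]

/-- All other entries vanish ("in one step the state can increase or decrease by at most `1`").
[cite: LevinPeres2017, §2.5] -/
theorem bdKernel_apply_of_ne {i j : Fin (n + 1)} (h1 : j.val ≠ i.val + 1) (h2 : i.val ≠ j.val + 1)
    (h3 : i ≠ j) : bdKernel n p q i j = 0 := by
  show (if j.val = i.val + 1 then p i.val else if i.val = j.val + 1 then q i.val
    else if i = j then 1 - p i.val - q i.val else 0) = 0
  rw [if_neg h1, if_neg h2, if_neg h3]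

/-- The nested case distinction as a sum of three exclusive indicator terms.
[cite: LevinPeres2017, §2.5 (definition)] -/
theorem bdKernel_apply_eq_add (i j : Fin (n + 1)) :
    bdKernel n p q i j = (if j.val = i.val + 1 then p i.val else 0) +
      (if i.val = j.val + 1 then q i.val else 0) + (if i = j then 1 - p i.val - q i.val else 0) := by
  by_cases h1 : j.val = i.val + 1
  · have h2 : ¬ i.val = j.val + 1 := by omega
    have h3 : i ≠ j := fun h => by rw [h] at h1; omega
    rw [bdKernel_apply_succ h1, if_pos h1, if_neg h2, if_neg h3, add_zero, add_zero]
  by_cases h2 : i.val = j.val + 1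
  · have h3 : i ≠ j := fun h => by rw [h] at h2; omega
    rw [bdKernel_apply_pred h2, if_neg h1, if_pos h2, if_neg h3, zero_add, add_zero]
  by_cases h3 : i = j
  · subst h3
    rw [bdKernel_apply_self, if_neg h1, if_neg h2, if_pos rfl, zero_add, zero_add]
  · rw [bdKernel_apply_of_ne h1 h2 h3, if_neg h1, if_neg h2, if_neg h3, add_zero, add_zero]

/-! ## Row sums -/

/-- `Σ_j 1{j = k+1} p_k = p_k` if `k < n`, and `0` at the top state `k = n`.
[cite: LevinPeres2017, §2.5 (`p_k` … when `0 ≤ k < n`)] -/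
theorem sum_ite_succ (i : Fin (n + 1)) (c : ℝ) :
    ∑ j : Fin (n + 1), (if j.val = i.val + 1 then c else 0) = if i.val < n then c else 0 := by
  by_cases hi : i.val < n
  · rw [if_pos hi]
    have key : ∀ j : Fin (n + 1), (j.val = i.val + 1) ↔ j = ⟨i.val + 1, by omega⟩ := fun j => by
      rw [Fin.ext_iff]
    simp_rw [key]
    rw [sum_ite_eq' univ]
    simp
  · rw [if_neg hi]
    refine sum_eq_zero fun j _ => ?_
    rw [if_neg]
    have := j.isLt
    omega

/-- `Σ_j 1{k = j+1} q_k = q_k` if `0 < k`, and `0` at the bottom state `k = 0`.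
[cite: LevinPeres2017, §2.5 (`q_k` … when `0 < k ≤ n`)] -/
theorem sum_ite_pred (i : Fin (n + 1)) (c : ℝ) :
    ∑ j : Fin (n + 1), (if i.val = j.val + 1 then c else 0) = if 0 < i.val then c else 0 := by
  by_cases hi : 0 < i.val
  · rw [if_pos hi]
    have key : ∀ j : Fin (n + 1), (i.val = j.val + 1) ↔ j = ⟨i.val - 1, by omega⟩ := fun j => by
      rw [Fin.ext_iff]
      constructor <;> intro h <;> simp only at h ⊢ <;> omega
    simp_rw [key]
    rw [sum_ite_eq' univ]
    simp
  · rw [if_neg hi]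
    refine sum_eq_zero fun j _ => ?_
    rw [if_neg]
    omega

/-- **Row sums**: `Σ_j P(k,j) = p_k 1{k<n} + q_k 1{k>0} + r_k = 1` when `q_0 = p_n = 0`.
[cite: LevinPeres2017, §2.5 ("`p_k + r_k + q_k = 1` for each `k` and … `q_0 = p_n = 0`")] -/
theorem sum_bdKernel (hq0 : q 0 = 0) (hpn : p n = 0) (i : Fin (n + 1)) :
    ∑ j, bdKernel n p q i j = 1 := by
  simp_rw [bdKernel_apply_eq_add, sum_add_distrib]
  rw [sum_ite_succ, sum_ite_pred, sum_ite_eq univ i]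
  simp only [mem_univ, if_true]
  by_cases h1 : i.val < n <;> by_cases h2 : 0 < i.val <;> simp only [h1, h2, if_true, if_false]
  · ring
  · have hi : i.val = 0 := by omega
    rw [hi, hq0]; ring
  · have hi : i.val = n := by have := i.isLt; omega
    rw [hi, hpn]; ring
  · have hi : i.val = 0 := by omega
    have hn : n = 0 := by omega
    rw [hi, hq0]
    rw [hn] at hpn
    rw [hpn]; ring

/-- **A birth-and-death chain is a transition matrix** (`p, q ≥ 0`, `p_k + q_k ≤ 1`, `q_0 = p_n = 0`).
[cite: LevinPeres2017, §2.5 (definition)] -/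
theorem bdKernel_isRowStochastic (hp : ∀ k, 0 ≤ p k) (hq : ∀ k, 0 ≤ q k) (hpq : ∀ k, p k + q k ≤ 1)
    (hq0 : q 0 = 0) (hpn : p n = 0) : IsRowStochastic (bdKernel n p q) := by
  refine ⟨fun i j => ?_, sum_bdKernel hq0 hpn⟩
  rw [bdKernel_apply_eq_add]
  refine add_nonneg (add_nonneg ?_ ?_) ?_
  · split_ifs
    · exact hp _
    · exact le_rfl
  · split_ifs
    · exact hq _
    · exact le_rfl
  · split_ifs
    · linarith [hpq i.val]
    · exact le_rfl

/-! ## The weights `w_k` and Proposition 2.8 -/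

/-- `w_0 = 1`. [cite: LevinPeres2017, §2.5, proof of Prop. 2.8] -/
theorem bdWeight_zero (p q : ℕ → ℝ) : bdWeight p q 0 = 1 := by
  simp [bdWeight]

/-- `w_{k+1} = w_k · p_k/q_{k+1}`. [cite: LevinPeres2017, §2.5, proof of Prop. 2.8] -/
theorem bdWeight_succ (p q : ℕ → ℝ) (k : ℕ) :
    bdWeight p q (k + 1) = bdWeight p q k * (p k / q (k + 1)) := by
  unfold bdWeight
  rw [prod_range_succ]

/-- `w_k ≥ 0` for `p, q ≥ 0`. [cite: LevinPeres2017, §2.5, proof of Prop. 2.8] -/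
theorem bdWeight_nonneg (hp : ∀ k, 0 ≤ p k) (hq : ∀ k, 0 ≤ q k) (k : ℕ) : 0 ≤ bdWeight p q k :=
  prod_nonneg fun i _ => div_nonneg (hp i) (hq (i + 1))

/-- **The detailed balance recursion `p_k w_k = q_{k+1} w_{k+1}`** (as printed: `p_{k−1}w_{k−1} =
q_k w_k` for `1 ≤ k ≤ n`), for `q_{k+1} ≠ 0`. [cite: LevinPeres2017, §2.5, proof of Prop. 2.8 ("`w`
satisfies the detailed balance equations (1.29) if and only if `p_{k−1}w_{k−1} = q_k w_k`")] -/
theorem bdWeight_balance {k : ℕ} (hq : q (k + 1) ≠ 0) :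
    p k * bdWeight p q k = q (k + 1) * bdWeight p q (k + 1) := by
  rw [bdWeight_succ]
  field_simp

/-- **PROPOSITION 2.8: every birth-and-death chain is reversible** — the weights `w_k` satisfy the
detailed balance equations `w_i P(i,j) = w_j P(j,i)` (death probabilities `q_k ≠ 0` for `1 ≤ k ≤ n`,
as the printed solution `w_k = Π p_{i−1}/q_i` requires). [cite: LevinPeres2017, §2.5 Prop. 2.8] -/
theorem LevinPeres2017_prop_2_8 (hq : ∀ k, 1 ≤ k → k ≤ n → q k ≠ 0) :
    DetailedBalance (fun i : Fin (n + 1) => bdWeight p q i.val) (bdKernel n p q) := by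
  intro i j
  show bdWeight p q i.val * bdKernel n p q i j = bdWeight p q j.val * bdKernel n p q j i
  by_cases h1 : j.val = i.val + 1
  · -- a birth `i → j = i + 1` against the death `j → i`
    have hqj : q (i.val + 1) ≠ 0 := hq (i.val + 1) (by omega) (by have := j.isLt; omega)
    rw [bdKernel_apply_succ h1, bdKernel_apply_pred h1, h1, mul_comm (bdWeight p q i.val),
      mul_comm (bdWeight p q (i.val + 1))]
    exact bdWeight_balance hqj
  by_cases h2 : i.val = j.val + 1
  · have hqi : q (j.val + 1) ≠ 0 := hq (j.val + 1) (by omega) (by have := i.isLt; omega)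
    rw [bdKernel_apply_pred h2, bdKernel_apply_succ h2, h2, mul_comm (bdWeight p q (j.val + 1)),
      mul_comm (bdWeight p q j.val)]
    exact (bdWeight_balance hqi).symm
  by_cases h3 : i = j
  · subst h3
    rfl
  · rw [bdKernel_apply_of_ne h1 h2 h3, bdKernel_apply_of_ne (by omega) (by omega) (Ne.symm h3),
      mul_zero, mul_zero]

/-- `Σ_j w_j > 0` (`w_0 = 1`, `w ≥ 0`). [cite: LevinPeres2017, §2.5, proof of Prop. 2.8 (the
normalisation)] -/
theorem sum_bdWeight_pos (hp : ∀ k, 0 ≤ p k) (hq : ∀ k, 0 ≤ q k) :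
    0 < ∑ j : Fin (n + 1), bdWeight p q j.val := by
  have h0 : bdWeight p q (0 : Fin (n + 1)).val = 1 := by
    rw [Fin.val_zero, bdWeight_zero]
  calc (0 : ℝ) < 1 := one_pos
    _ = bdWeight p q (0 : Fin (n + 1)).val := h0.symm
    _ ≤ ∑ j : Fin (n + 1), bdWeight p q j.val :=
        single_le_sum (f := fun j : Fin (n + 1) => bdWeight p q j.val)
          (fun j _ => bdWeight_nonneg hp hq j.val) (mem_univ 0)

/-- `π = w/Σw` sums to one (`p, q ≥ 0`). [cite: LevinPeres2017, §2.5, proof of Prop. 2.8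
("Normalizing so that the sum is unity")] -/
theorem sum_bdLaw (hp : ∀ k, 0 ≤ p k) (hq : ∀ k, 0 ≤ q k) : ∑ k, bdLaw n p q k = 1 := by
  unfold bdLaw
  rw [← sum_div, div_self (sum_bdWeight_pos hp hq).ne']

/-- `π ≥ 0`. [cite: LevinPeres2017, §2.5, proof of Prop. 2.8] -/
theorem bdLaw_nonneg (hp : ∀ k, 0 ≤ p k) (hq : ∀ k, 0 ≤ q k) (k : Fin (n + 1)) :
    0 ≤ bdLaw n p q k :=
  div_nonneg (bdWeight_nonneg hp hq k.val) (sum_bdWeight_pos (n := n) hp hq).le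

/-- **Proposition 2.8 for the normalised law**: `π_k = w_k/Σ_j w_j` is in detailed balance with the
birth-and-death chain. [cite: LevinPeres2017, §2.5 Prop. 2.8] -/
theorem LevinPeres2017_prop_2_8_law (hq : ∀ k, 1 ≤ k → k ≤ n → q k ≠ 0) :
    DetailedBalance (bdLaw n p q) (bdKernel n p q) := by
  intro i j
  unfold bdLaw
  rw [div_mul_eq_mul_div, div_mul_eq_mul_div, LevinPeres2017_prop_2_8 hq i j]

/-- **`π` is a stationary distribution** of the birth-and-death chain ("By Proposition 1.20, `π` is
also a stationary distribution"). [cite: LevinPeres2017, §2.5 Prop. 2.8 (proof, last sentence) with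
§1.6 Prop. 1.20] -/
theorem bdLaw_isStationary (hq : ∀ k, 1 ≤ k → k ≤ n → q k ≠ 0) (hq0 : q 0 = 0) (hpn : p n = 0) :
    IsStationary (bdLaw n p q) (bdKernel n p q) :=
  (LevinPeres2017_prop_2_8_law hq).isStationary (sum_bdKernel hq0 hpn)

end Literature.Probability.MarkovChains
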